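import Summits.CriticalPhenomena.PercolationContinuityZ3.Theorems.PercNearOneGluingNoHeavyLowerTailThreePointProductFormFibreAdjacent
import Summits.CriticalPhenomena.PercolationContinuityZ3.Theorems.PercNearOneGluingNoHeavyLowerTailThreePointProductFormFibreFlat
import HarnessLib

/-!
# The product form in the fibre language: A FLAT CONNECTION ENTERS A CLUSTER THROUGH A CLOSED LABEL FROM THE APEX CLUSTER
# — the adjacency refinement `(P-adj)` of CONJECTURE (P) and its first cases (Sahi programme, prover prim-sahi-p2 gen 56)

Support file (`--supports stmt-CriticalPhenomena-4575`, helper); continues `…ThreePointProductFormFibreFlat` (two-point fact `V ≤ Cn`,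
`V ≤ Dn`) and `…ThreePointProductFormFibreAdjacent` (`#S0 ≤ #P1` when the apex is adjacent to `s`).  Standard axioms, no sorries, no named
facts, no definitions.  Memo `run/shared/lean/prim/prim-sahi/FROM-prim-sahi-p2-gen56-*.md` §2 and PROOF-E3 §66.

With `R z x y` = open connection at `z : α → Bool`, `K = C_a(z)` the apex cluster and `♭z = clusterFlip ends a z̄` (complement every label
touching `K`): two clusters of `z` are ADJACENT when some CLOSED label of the multigraph joins them.
* **`exists_closed_label_of_flat_walk`** [this work] — THE ENTRY LEMMA: if `t ∉ K` and a `♭z`-open walk runs from a vertex of the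
  `z`-cluster `C_t` of `t` to a vertex outside `C_t`, then some closed label joins `K` to `C_t` (the first label of the walk leaving `C_t` is
  `♭z`-open and `z`-closed, hence touched by `K`, and its endpoint inside `C_t` is not in `K`).
* `adjacent_of_virtual` [this work] — two points: `a ↮ t` in `z` and `a ↔ t` in `♭z` ⟹ `K` and `C_t` are adjacent; hence the REFINED
  TWO-POINT FACT `card_virtual_le_card_disc_adj` (`V ≤ Dn^adj := #{a ↮ t, K adjacent to C_t}`) and `virtual_sq_le_conn_mul_disc_adj`
  (`V² ≤ Cn · Dn^adj`), sharpening `…FibreFlat`.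
* `adjacent_of_bad_left/right` [this work] — three points: in a bad configuration (`a ↮ s, a ↮ c, s ↮ c`, `s ↔ c` in `♭z`) the apex
  cluster is adjacent to the cluster of `s` AND to the cluster of `c` (`card_bad_le_card_sep_adj`: `#bad ≤ #{z ∈ S0 : K adj C_s, K adj C_c}`,
  the set `bad*` of the gen-54 memo §0(5)).
* **`productFormAdj_of_labels`** [this work] — THE ADJACENCY REFINEMENT (P-adj) IN THE DOUBLY-ADJACENT CASE: if the apex carries labels to
  `s` and to `c`, then `#bad² ≤ #P1ᵃ · #P2ᵃ` with `P1ᵃ = {a ↔ s, a ↮ c, K adjacent to C_c} ⊆ P1`, `P2ᵃ = {a ↔ c, a ↮ s, K adjacent to C_s} ⊆ P2`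
  (opening the `a–s` label maps `bad` injectively into `P1ᵃ`: the closed `K–C_c` label of the entry lemma survives).
CONJECTURE (P-adj) [this work, gen 56; census kit j340568: 0 exceptions, see the memo] is `#bad² ≤ #P1ᵃ · #P2ᵃ` on every finite multigraph;
its sharper census form (P♮) replaces `K` in `P1ᵃ` by the cluster of `a` computed without the labels at `s` and has ASYMMETRIC equality cases
`(#bad, #P1♮, #P2♮) = (b, b/2, 2b)`.  (P-adj) ⟹ (P).  [folklore] (first-exit argument along a walk);
[cite: Gladkov2024, Conjecture 10.1 (p. 18), arXiv:2408.08457] for CONJECTURE (P) served.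
-/

namespace Summit.CriticalPhenomena.PercolationContinuityZ3.Theorems.ProductFormFibre

open Finset Literature.Probability.Percolation
open Summit.CriticalPhenomena.PercolationContinuityZ3.Theorems.ThreePointCPIClusterSwap
  (CReach QTouch clusterFlip clusterFlip_of_not_qtouch)

variable {V α : Type*}

section Entry

variable (ends : α → Sym2 V) (a : V)

/-- A label on which `z` and its flat differ is touched by the apex cluster: some endpoint is joined to `a` in `z`. [this work] -/
theorem exists_reachable_of_flat_ne (z : α → Bool) {l : α}
    (h : clusterFlip ends a (fun l' => !z l') l ≠ z l) :
    ∃ v ∈ ends l, (openGraph (labelledOpen ends z)).Reachable a v := by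
  by_contra hne
  push Not at hne
  apply h
  have hq : ¬ QTouch ends a (fun l' => !z l') l := by
    rintro ⟨v, hv, hr⟩
    apply hne v hv
    simp only [CReach, Bool.not_not] at hr
    exact hr
  rw [clusterFlip_of_not_qtouch ends a _ hq, Bool.not_not]

/-- **THE ENTRY LEMMA.**  Let `t` be separated from the apex in `z`.  If a `♭z`-open walk runs from a vertex `y` of the `z`-cluster of `t`
to a vertex `u` outside it, then some `z`-closed label joins the apex cluster to the cluster of `t`: there are `l`, `x`, `y'` with
`z l = false`, `ends l = s(x, y')`, `a ↔ x` and `t ↔ y'` in `z`. [this work] -/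
theorem exists_closed_label_of_flat_walk (z : α → Bool) {t : V}
    (hat : ¬ (openGraph (labelledOpen ends z)).Reachable a t) :
    ∀ {y u : V} (_ : (openGraph (labelledOpen ends (clusterFlip ends a fun l => !z l))).Walk y u),
      (openGraph (labelledOpen ends z)).Reachable t y → ¬ (openGraph (labelledOpen ends z)).Reachable t u →
      ∃ l, z l = false ∧ ∃ x y' : V, ends l = s(x, y') ∧
        (openGraph (labelledOpen ends z)).Reachable a x ∧ (openGraph (labelledOpen ends z)).Reachable t y'
  | _, _, .nil, hty, htu => (htu hty).elim
  | y, u, .cons (v := y₁) hadj p, hty, htu => by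
      rw [openGraph_adj] at hadj
      obtain ⟨⟨l, hl, hle⟩, hne⟩ := hadj
      by_cases hz : z l = true
      · have hadj' : (openGraph (labelledOpen ends z)).Adj y y₁ := by
          rw [openGraph_adj]; exact ⟨⟨l, hz, hle⟩, hne⟩
        exact exists_closed_label_of_flat_walk z hat p (hty.trans hadj'.reachable) htu
      · have hzf : z l = false := by cases h' : z l <;> simp_all
        have hdiff : clusterFlip ends a (fun l' => !z l') l ≠ z l := by rw [hl, hzf]; decide
        obtain ⟨v, hv, hav⟩ := exists_reachable_of_flat_ne ends a z hdiff
        rw [hle, Sym2.mem_iff] at hv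
        rcases hv with rfl | rfl
        · exact (hat (hav.trans hty.symm)).elim
        · exact ⟨l, hzf, v, y, hle.trans Sym2.eq_swap, hav, hty⟩

/-- **Two points: a virtual connection is an adjacency.**  If `a ↮ t` in `z` but `a ↔ t` in `♭z`, then some closed label joins the apex
cluster to the cluster of `t`. [this work] -/
theorem adjacent_of_virtual (z : α → Bool) {t : V}
    (hat : ¬ (openGraph (labelledOpen ends z)).Reachable a t)
    (hft : (openGraph (labelledOpen ends (clusterFlip ends a fun l => !z l))).Reachable a t) :
    ∃ l, z l = false ∧ ∃ x y' : V, ends l = s(x, y') ∧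
      (openGraph (labelledOpen ends z)).Reachable a x ∧ (openGraph (labelledOpen ends z)).Reachable t y' := by
  obtain ⟨p⟩ := hft.symm
  exact exists_closed_label_of_flat_walk ends a z hat p (SimpleGraph.Reachable.refl t) (fun h => hat h.symm)

/-- **Three points, `c`-side**: in a configuration with `a ↮ c`, `s ↮ c` in `z` and `s ↔ c` in `♭z`, some closed label joins the apex
cluster to the cluster of `c`. [this work] -/
theorem adjacent_of_bad_right (z : α → Bool) {s c : V}
    (hac : ¬ (openGraph (labelledOpen ends z)).Reachable a c) (hsc : ¬ (openGraph (labelledOpen ends z)).Reachable s c)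
    (hf : (openGraph (labelledOpen ends (clusterFlip ends a fun l => !z l))).Reachable s c) :
    ∃ l, z l = false ∧ ∃ x y' : V, ends l = s(x, y') ∧
      (openGraph (labelledOpen ends z)).Reachable a x ∧ (openGraph (labelledOpen ends z)).Reachable c y' := by
  obtain ⟨p⟩ := hf.symm
  exact exists_closed_label_of_flat_walk ends a z hac p (SimpleGraph.Reachable.refl c) (fun h => hsc h.symm)

/-- **Three points, `s`-side**: with `a ↮ s`, `s ↮ c` in `z` and `s ↔ c` in `♭z`, some closed label joins the apex cluster to the
cluster of `s`. [this work] -/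
theorem adjacent_of_bad_left (z : α → Bool) {s c : V}
    (has : ¬ (openGraph (labelledOpen ends z)).Reachable a s) (hsc : ¬ (openGraph (labelledOpen ends z)).Reachable s c)
    (hf : (openGraph (labelledOpen ends (clusterFlip ends a fun l => !z l))).Reachable s c) :
    ∃ l, z l = false ∧ ∃ x y' : V, ends l = s(x, y') ∧
      (openGraph (labelledOpen ends z)).Reachable a x ∧ (openGraph (labelledOpen ends z)).Reachable s y' := by
  obtain ⟨p⟩ := hf
  exact exists_closed_label_of_flat_walk ends a z has p (SimpleGraph.Reachable.refl s) hsc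

end Entry

/-! ### Counting corollaries -/

section Counts

variable (ends : α → Sym2 V) (a : V) [Fintype α] [DecidableEq α]

open Classical in
/-- **Refined two-point fact `V ≤ Dn^adj`**: the virtually joined configurations (`a ↮ t` in `z`, `a ↔ t` in `♭z`) are among those with
`a ↮ t` whose apex cluster is adjacent to the cluster of `t`. [this work] -/
theorem card_virtual_le_card_disc_adj (t : V) :
    (univ.filter fun z : α → Bool =>
        ¬ (openGraph (labelledOpen ends z)).Reachable a t ∧
        (openGraph (labelledOpen ends (clusterFlip ends a fun l => !z l))).Reachable a t).card ≤
    (univ.filter fun z : α → Bool =>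
        ¬ (openGraph (labelledOpen ends z)).Reachable a t ∧
        ∃ l, z l = false ∧ ∃ x y' : V, ends l = s(x, y') ∧
          (openGraph (labelledOpen ends z)).Reachable a x ∧ (openGraph (labelledOpen ends z)).Reachable t y').card := by
  refine Finset.card_le_card ?_
  intro z hz
  rw [Finset.mem_filter] at hz ⊢
  exact ⟨hz.1, hz.2.1, adjacent_of_virtual ends a z hz.2.1 hz.2.2⟩

open Classical in
/-- **`V² ≤ Cn · Dn^adj`** — the refined two-point matrix `[[Cn, V],[V, Dn^adj]]` is positive semidefinite. [this work] -/
theorem virtual_sq_le_conn_mul_disc_adj (t : V) :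
    (univ.filter fun z : α → Bool =>
        ¬ (openGraph (labelledOpen ends z)).Reachable a t ∧
        (openGraph (labelledOpen ends (clusterFlip ends a fun l => !z l))).Reachable a t).card ^ 2 ≤
    (univ.filter fun z : α → Bool => (openGraph (labelledOpen ends z)).Reachable a t).card *
    (univ.filter fun z : α → Bool =>
        ¬ (openGraph (labelledOpen ends z)).Reachable a t ∧
        ∃ l, z l = false ∧ ∃ x y' : V, ends l = s(x, y') ∧
          (openGraph (labelledOpen ends z)).Reachable a x ∧ (openGraph (labelledOpen ends z)).Reachable t y').card := by
  rw [sq]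
  exact Nat.mul_le_mul (card_virtual_le_card_conn ends a t) (card_virtual_le_card_disc_adj ends a t)

open Classical in
/-- **`#bad ≤ #bad*`**: every bad configuration (`a ↮ s, a ↮ c, s ↮ c` in `z`, `s ↔ c` in `♭z`) has its apex cluster adjacent to the
cluster of `s` and to the cluster of `c` (gen-54 memo §0(5): the converse inclusion is false). [this work] -/
theorem card_bad_le_card_sep_adj (s c : V) :
    (univ.filter fun z : α → Bool =>
        (¬ (openGraph (labelledOpen ends z)).Reachable a s ∧ ¬ (openGraph (labelledOpen ends z)).Reachable a c ∧
          ¬ (openGraph (labelledOpen ends z)).Reachable s c) ∧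
        (openGraph (labelledOpen ends (clusterFlip ends a fun l => !z l))).Reachable s c).card ≤
    (univ.filter fun z : α → Bool =>
        (¬ (openGraph (labelledOpen ends z)).Reachable a s ∧ ¬ (openGraph (labelledOpen ends z)).Reachable a c ∧
          ¬ (openGraph (labelledOpen ends z)).Reachable s c) ∧
        (∃ l, z l = false ∧ ∃ x y' : V, ends l = s(x, y') ∧
          (openGraph (labelledOpen ends z)).Reachable a x ∧ (openGraph (labelledOpen ends z)).Reachable s y') ∧
        (∃ l, z l = false ∧ ∃ x y' : V, ends l = s(x, y') ∧
          (openGraph (labelledOpen ends z)).Reachable a x ∧ (openGraph (labelledOpen ends z)).Reachable c y')).card := by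
  refine Finset.card_le_card ?_
  intro z hz
  rw [Finset.mem_filter] at hz ⊢
  obtain ⟨-, ⟨has, hac, hsc⟩, hf⟩ := hz
  exact ⟨Finset.mem_univ _, ⟨has, hac, hsc⟩, adjacent_of_bad_left ends a z has hsc hf,
    adjacent_of_bad_right ends a z hac hsc hf⟩

open Classical in
/-- **`#bad ≤ #P1ᵃ` when the apex carries a label to `s`.**  Opening an `a–s` label `ℓ` maps the bad configurations injectively into
`P1ᵃ = {a ↔ s, a ↮ c, apex cluster adjacent to the cluster of c}`: the closed label from `C_a(z)` to `C_c(z)` given by the entry lemma is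
not `ℓ` (its far endpoint lies in `C_c(z) ∌ s, a`) and stays closed, and `C_a(z) ⊆ C_a(z + ℓ)`. [this work] -/
theorem card_bad_le_card_saAdj_of_label {s c : V} {ℓ : α} (hℓ : ends ℓ = s(a, s)) (has : a ≠ s) :
    (univ.filter fun z : α → Bool =>
        (¬ (openGraph (labelledOpen ends z)).Reachable a s ∧ ¬ (openGraph (labelledOpen ends z)).Reachable a c ∧
          ¬ (openGraph (labelledOpen ends z)).Reachable s c) ∧
        (openGraph (labelledOpen ends (clusterFlip ends a fun l => !z l))).Reachable s c).card ≤
    (univ.filter fun z : α → Bool =>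
        ((openGraph (labelledOpen ends z)).Reachable a s ∧ ¬ (openGraph (labelledOpen ends z)).Reachable a c) ∧
        ∃ l, z l = false ∧ ∃ x y' : V, ends l = s(x, y') ∧
          (openGraph (labelledOpen ends z)).Reachable a x ∧ (openGraph (labelledOpen ends z)).Reachable c y').card := by
  refine Finset.card_le_card_of_injOn (fun z => Function.update z ℓ true) ?_ ?_
  · intro z hz
    rw [Finset.mem_coe, Finset.mem_filter] at hz
    obtain ⟨-, ⟨hAS, hAC, hSC⟩, hf⟩ := hz
    rw [Finset.mem_coe, Finset.mem_filter]
    refine ⟨Finset.mem_univ _, ⟨reachable_update_true_self ends z hℓ has, fun hac => ?_⟩, ?_⟩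
    · rcases reachable_update_true ends z hℓ hac with h | h
      · exact hAC h
      · exact hSC h
    · obtain ⟨l, hzl, x, y', hle, hax, hcy⟩ := adjacent_of_bad_right ends a z hAC hSC hf
      have hlℓ : l ≠ ℓ := by
        rintro rfl
        rw [hℓ] at hle
        -- `y' ∈ s(a, s)` and `c ↔ y'`: contradicts `a ↮ c` or `s ↮ c`
        have hy' : y' ∈ (s(a, s) : Sym2 V) := by rw [hle]; exact Sym2.mem_mk_right x y'
        rcases Sym2.mem_iff.1 hy' with rfl | rfl
        · exact hAC hcy.symm
        · exact hSC hcy.symm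
      -- monotonicity of reachability under opening `ℓ`
      have hmono : ∀ {p q : V}, (openGraph (labelledOpen ends z)).Reachable p q →
          (openGraph (labelledOpen ends (Function.update z ℓ true))).Reachable p q := by
        intro p q hpq
        refine hpq.mono ?_
        intro u w huw
        rw [openGraph_adj] at huw ⊢
        obtain ⟨⟨b, hb, hbe⟩, hne⟩ := huw
        refine ⟨⟨b, ?_, hbe⟩, hne⟩
        by_cases hbℓ : b = ℓ
        · subst hbℓ; exact Function.update_self _ true z
        · rw [Function.update_of_ne hbℓ]; exact hb
      refine ⟨l, ?_, x, y', hle, hmono hax, hmono hcy⟩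
      show Function.update z ℓ true l = false
      rw [Function.update_of_ne hlℓ]; exact hzl
  · intro z₁ hz₁ z₂ hz₂ heq
    rw [Finset.mem_coe, Finset.mem_filter] at hz₁ hz₂
    have h₁ : z₁ ℓ = false := apply_eq_false_of_not_reachable ends z₁ hℓ has hz₁.2.1.1
    have h₂ : z₂ ℓ = false := apply_eq_false_of_not_reachable ends z₂ hℓ has hz₂.2.1.1
    funext b
    by_cases hb : b = ℓ
    · rw [hb, h₁, h₂]
    · have := congrArg (fun w : α → Bool => w b) heq
      simpa only [Function.update_of_ne hb] using this

open Classical in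
/-- **CONJECTURE (P-adj) in the doubly-adjacent case.**  If the apex `a` carries labels to both `s` and `c` (`a ≠ s`, `a ≠ c`), then
`#bad² ≤ #P1ᵃ · #P2ᵃ` where `P1ᵃ = {a ↔ s, a ↮ c, C_a adjacent to C_c}` and `P2ᵃ = {a ↔ c, a ↮ s, C_a adjacent to C_s}` (adjacent = joined by a
closed label); indeed `#bad ≤ #P1ᵃ` and `#bad ≤ #P2ᵃ`.  This refines `productForm_of_labels` (`…FibreAdjacent`). [this work] -/
theorem productFormAdj_of_labels {s c : V} {ℓ₁ ℓ₂ : α} (h₁ : ends ℓ₁ = s(a, s)) (h₂ : ends ℓ₂ = s(a, c))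
    (has : a ≠ s) (hac : a ≠ c) :
    (univ.filter fun z : α → Bool =>
        (¬ (openGraph (labelledOpen ends z)).Reachable a s ∧ ¬ (openGraph (labelledOpen ends z)).Reachable a c ∧
          ¬ (openGraph (labelledOpen ends z)).Reachable s c) ∧
        (openGraph (labelledOpen ends (clusterFlip ends a fun l => !z l))).Reachable s c).card ^ 2 ≤
    (univ.filter fun z : α → Bool =>
        ((openGraph (labelledOpen ends z)).Reachable a s ∧ ¬ (openGraph (labelledOpen ends z)).Reachable a c) ∧
        ∃ l, z l = false ∧ ∃ x y' : V, ends l = s(x, y') ∧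
          (openGraph (labelledOpen ends z)).Reachable a x ∧ (openGraph (labelledOpen ends z)).Reachable c y').card *
    (univ.filter fun z : α → Bool =>
        ((openGraph (labelledOpen ends z)).Reachable a c ∧ ¬ (openGraph (labelledOpen ends z)).Reachable a s) ∧
        ∃ l, z l = false ∧ ∃ x y' : V, ends l = s(x, y') ∧
          (openGraph (labelledOpen ends z)).Reachable a x ∧ (openGraph (labelledOpen ends z)).Reachable s y').card := by
  have hP1 := card_bad_le_card_saAdj_of_label ends a (c := c) h₁ has
  have hP2' := card_bad_le_card_saAdj_of_label ends a (c := s) h₂ hac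
  have hP2 : (univ.filter fun z : α → Bool =>
        (¬ (openGraph (labelledOpen ends z)).Reachable a s ∧ ¬ (openGraph (labelledOpen ends z)).Reachable a c ∧
          ¬ (openGraph (labelledOpen ends z)).Reachable s c) ∧
        (openGraph (labelledOpen ends (clusterFlip ends a fun l => !z l))).Reachable s c).card ≤
      (univ.filter fun z : α → Bool =>
        ((openGraph (labelledOpen ends z)).Reachable a c ∧ ¬ (openGraph (labelledOpen ends z)).Reachable a s) ∧
        ∃ l, z l = false ∧ ∃ x y' : V, ends l = s(x, y') ∧
          (openGraph (labelledOpen ends z)).Reachable a x ∧ (openGraph (labelledOpen ends z)).Reachable s y').card := by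
    refine le_trans (le_of_eq ?_) hP2'
    congr 1
    ext z
    simp only [Finset.mem_filter, Finset.mem_univ, true_and]
    constructor
    · rintro ⟨⟨h1, h2, h3⟩, h4⟩
      exact ⟨⟨h2, h1, fun h => h3 h.symm⟩, h4.symm⟩
    · rintro ⟨⟨h1, h2, h3⟩, h4⟩
      exact ⟨⟨h2, h1, fun h => h3 h.symm⟩, h4.symm⟩
  calc _ = _ * _ := sq _
    _ ≤ _ := Nat.mul_le_mul hP1 hP2

end Counts

end Summit.CriticalPhenomena.PercolationContinuityZ3.Theorems.ProductFormFibre
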